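import Summits.ResolutionOfSingularities.ResolutionOfSingularities.Theorems.FrobeniusLadderFInjectiveMacaulayficationRadTauLoopConditional
import Summits.ResolutionOfSingularities.ResolutionOfSingularities.Theorems.FrobeniusLadderFInjectiveMacaulayficationSingTowerNesting
import Summits.ResolutionOfSingularities.ResolutionOfSingularities.Theorems.FrobeniusLadderFInjectiveMacaulayficationIntrinsicTowerInstanceP2d4C
import Summits.ResolutionOfSingularities.ResolutionOfSingularities.Theorems.FrobeniusLadderFInjectiveMacaulayficationLoopGermLCharts
import Summits.ResolutionOfSingularities.ResolutionOfSingularities.Theorems.FrobeniusLadderFInjectiveMacaulayficationStrictTransformChartSub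
import Literature.AlgebraicGeometry.Resolution.AffineBlowupUnique
import Literature.AlgebraicGeometry.Resolution.AffineBlowupUniversal
import Literature.AlgebraicGeometry.Resolution.AffineBlowupCartier
import Literature.RingTheory.MvPolynomial.VariableIdeals
import HarnessLib

/-!
# (L-g) NEG-N FRAME: the period-one N-loop germ `U₀` of d4lx6c3 — chart identity, the chart open immersion `U₀ ⟶ Bl_{(x,y,z)} U₀`, the centre identification (modulo the two-sided
# locus lemma), and the receivers `¬ ∃ n, RecipeTowerFull nonFullCentre 2 n S` / `¬ NonFullTowerConjecture` (+ the v1 twins for `IntrinsicTower.TowerFull` / `IntrinsicTowerConjecture`)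
# (crux `FInjectiveMacaulayfication` stmt-ResolutionOfSingularities-15315, chain w45a; res-L1-w45a-plan-1 RULING R19.21 «NEG-N», piece (L-g); seat res-L1-w45a-lead-1 g9; bed and floor table
# by res-L1-w45a-idea-1 FB5-r6 §1.5, replayed by res-L1-w45a-tri-2 g16 (bus l.81567); receivers p635381, bad-prefix lemma p642899, chart brick `…StrictTransformChartSub`)

[OURS · L1 W4.5a] Support file (`--supports stmt-ResolutionOfSingularities-15315 --as helper`); def-free, fact-free; NOTHING of the crux is proved and NO route item is refuted —
`NonFullTowerConjecture` / `IntrinsicTowerConjecture` are OUR OWN candidate statements (`@[conjecture]`, p632743 / p631380), already refuted BY EVIDENCE (R19.7); this file is the frame of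
their KERNEL refutation. AI-written (weaker than expert review).

THE GERM (tri-2 l.81567, floor 5 of the N-tower of `X = {z² + x⁶z + y³ + u³ + t³} ⊂ 𝔸⁵_{𝔽₂}`; letters `x = X 0`, `y = X 1`, `u = X 2`, `t = X 3`, `z = X 4`):
`g₅ = z² + x²y·z + xy²(1 + u³ + t³) = X 4 ^ 2 + X 0 ^ 2 * X 1 * X 4 + X 0 * X 1 ^ 2 * X 2 ^ 3 + X 0 * X 1 ^ 2 * X 3 ^ 3 + X 0 * X 1 ^ 2`, `U₀ = Spec k[X]/(g₅)`, N-centre `(x, y, z) = (X 0, X 1, X 4)`,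
chart `D(x t)`: `g₅(x, xy, u, t, xz) = x² · g₅` — the blow-up chart IS `U₀` again (period one).
* §1 ring facts: `prime_g5`, `isPrime_span_g5`, `X0_not_mem_span_g5`, ★ `chart_identity_g5` (`ring`), `g5_mem_span_centre`;
* §2 `isPrime_centre` (`(x̄, ȳ, z̄) ⊂ k[X]/(g₅)` is prime: `k[X]/(g₅, x, y, z) = k[u, t]`);
* §3 ★ `exists_chart_isOpenImmersion : ∃ j : U₀ ⟶ Bl_{(x̄,ȳ,z̄)} U₀, IsOpenImmersion j` (`StrictTransformChartSub.strictTransformChartSub` + `affineBlowup.chartι`);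
* §4 under the TWO-SIDED LOCUS HYPOTHESIS `hlocus : ∀ w, ¬ FullCl 2 (𝒪_{U₀,w}) ↔ (x̄, ȳ, z̄) ≤ w` (discharged in NEG-5 by res-L1-w45a-stub-1): `exists_not_fullCl`, ★ `nonFullCentre_eq` (`Recipes.nonFullCentre 2 U₀ =
  (x̄,ȳ,z̄)~`), `centre_eq` (the v1 centre, equal), ★★ `not_exists_nonFullTower_of_contains_U0 : ∀ S ⊇° U₀, ¬ ∃ n, RecipeTowerFull nonFullCentre 2 n S`, `not_exists_towerFull_of_contains_U0` (v1);
* §5 ★★ `not_nonFullTowerConjecture_of_occurrence` / `not_intrinsicTowerConjecture_of_occurrence`: given an N-tower prefix `F 0 ← … ← F m` of blowing ups along the N-centres with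
  non-FULL floors, `F 0` a floor at which the conjecture applies (`hfloor`, NEG-0), and an open immersion `U₀ ⟶ F m` (`hocc`, NEG-1…5), the conjecture is FALSE.
-/

-- single-problem summit: the doubled namespace component is forced
set_option linter.dupNamespace false

noncomputable section

open AlgebraicGeometry CategoryTheory CategoryTheory.Limits Literature.AlgebraicGeometry.Resolution TopologicalSpace IsLocalRing MvPolynomial

namespace Summit.ResolutionOfSingularities.ResolutionOfSingularities.Theorems.FInjectiveMacaulayfication.NonFullLoopFrame

open Summit.ResolutionOfSingularities.ResolutionOfSingularities.Theorems.FInjectiveMacaulayfication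
open SliceableCentre IntrinsicTower IntrinsicTower.Recipes FullCentreDescent

/-! ## §1 Ring facts on `g₅` -/

section Ring

variable (k : Type) [Field k]

/-- `g₅` is PRIME over any field: the monic quadric `T² + (x²y)·T + xy²(1+u³+t³)` in `z = T`; at `(x,y,u,t) = (0,1,0,0)` both lower coefficients vanish and `∂_x (xy²(1+u³+t³)) = 1`
(res-L1-w45a-stub-3's Eisenstein-type criterion `LoopGermLCharts.prime_of_quadric`). [folklore] -/
theorem prime_g5 (g : MvPolynomial (Fin 5) k) (hg : g = X 4 ^ 2 + X 0 ^ 2 * X 1 * X 4 + X 0 * X 1 ^ 2 * X 2 ^ 3 + X 0 * X 1 ^ 2 * X 3 ^ 3 + X 0 * X 1 ^ 2) : Prime g := by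
  refine LoopGermLCharts.prime_of_quadric k g (X 0 ^ 2 * X 1) (X 0 * X 1 ^ 2 * X 2 ^ 3 + X 0 * X 1 ^ 2 * X 3 ^ 3 + X 0 * X 1 ^ 2) ?_ ![0, 1, 0, 0] ?_ ?_ 0 ?_
  · rw [hg]; simp only [map_add, map_mul, map_pow, rename_X, Fin.castSucc_zero]; simp; ring
  · simp
  · simp
  · have e1 : pderiv 0 (X 0 * X 1 ^ 2 * X 2 ^ 3 + X 0 * X 1 ^ 2 * X 3 ^ 3 + X 0 * X 1 ^ 2 : MvPolynomial (Fin 4) k) =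
        X 1 ^ 2 * X 2 ^ 3 + X 1 ^ 2 * X 3 ^ 3 + X 1 ^ 2 := by
      simp only [map_add, Derivation.leibniz, Derivation.leibniz_pow, pderiv_X_self, smul_eq_mul, pderiv_X_of_ne (show (1 : Fin 4) ≠ 0 by decide),
        pderiv_X_of_ne (show (2 : Fin 4) ≠ 0 by decide), pderiv_X_of_ne (show (3 : Fin 4) ≠ 0 by decide)]
      push_cast; ring
    rw [e1]; simp

/-- `(g₅)` is a prime ideal. [folklore] -/
theorem isPrime_span_g5 (g : MvPolynomial (Fin 5) k) (hg : g = X 4 ^ 2 + X 0 ^ 2 * X 1 * X 4 + X 0 * X 1 ^ 2 * X 2 ^ 3 + X 0 * X 1 ^ 2 * X 3 ^ 3 + X 0 * X 1 ^ 2) :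
    (Ideal.span {g}).IsPrime :=
  (Ideal.span_singleton_prime (prime_g5 k g hg).ne_zero).mpr (prime_g5 k g hg)

/-- `x ∉ (g₅)`: evaluate at `(1,0,0,0,0)`, where `g₅` vanishes and `x` does not. [folklore] -/
theorem X0_not_mem_span_g5 (g : MvPolynomial (Fin 5) k) (hg : g = X 4 ^ 2 + X 0 ^ 2 * X 1 * X 4 + X 0 * X 1 ^ 2 * X 2 ^ 3 + X 0 * X 1 ^ 2 * X 3 ^ 3 + X 0 * X 1 ^ 2) :
    (X 0 : MvPolynomial (Fin 5) k) ∉ Ideal.span {g} := by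
  intro h
  obtain ⟨q, hq⟩ := Ideal.mem_span_singleton'.mp h
  have h1 := congrArg (MvPolynomial.eval (![1, 0, 0, 0, 0] : Fin 5 → k)) hq
  rw [map_mul, hg] at h1
  simp at h1

/-- ★ **THE CHART IDENTITY** `g₅(x, xy, u, t, xz) = x² · g₅`: under the chart substitution of `Bl_{(x,y,z)}` at `D(x t)` the total transform of `g₅` is `x²` times `g₅` ITSELF. [tri-2 l.81567; `ring`] -/
theorem chart_identity_g5 (g : MvPolynomial (Fin 5) k) (hg : g = X 4 ^ 2 + X 0 ^ 2 * X 1 * X 4 + X 0 * X 1 ^ 2 * X 2 ^ 3 + X 0 * X 1 ^ 2 * X 3 ^ 3 + X 0 * X 1 ^ 2) :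
    MvPolynomial.aeval (fun j : Fin 5 => if j ∈ ({0, 1, 4} : Finset (Fin 5)) ∧ j ≠ 0 then X j * X 0 else (X j : MvPolynomial (Fin 5) k)) g = X 0 ^ 2 * g := by
  rw [hg]
  simp only [map_add, map_mul, map_pow, MvPolynomial.aeval_X, Finset.mem_insert, Finset.mem_singleton]
  simp (config := { decide := true }) only [if_true, if_false]
  ring

/-- `g₅ ∈ (x, y, z)` in `k[X]` (`g₅ = z·(z + x²y) + x·y²(1+u³+t³)`). [folklore] -/
theorem g5_mem_span_centre (g : MvPolynomial (Fin 5) k) (hg : g = X 4 ^ 2 + X 0 ^ 2 * X 1 * X 4 + X 0 * X 1 ^ 2 * X 2 ^ 3 + X 0 * X 1 ^ 2 * X 3 ^ 3 + X 0 * X 1 ^ 2) :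
    g ∈ Ideal.span (X '' (({0, 1, 4} : Finset (Fin 5)) : Set (Fin 5)) : Set (MvPolynomial (Fin 5) k)) := by
  have h4 : (X 4 : MvPolynomial (Fin 5) k) ∈ Ideal.span (X '' (({0, 1, 4} : Finset (Fin 5)) : Set (Fin 5)) : Set (MvPolynomial (Fin 5) k)) :=
    Ideal.subset_span ⟨4, by simp, rfl⟩
  have h0 : (X 0 : MvPolynomial (Fin 5) k) ∈ Ideal.span (X '' (({0, 1, 4} : Finset (Fin 5)) : Set (Fin 5)) : Set (MvPolynomial (Fin 5) k)) :=
    Ideal.subset_span ⟨0, by simp, rfl⟩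
  have hdec : g = X 4 * (X 4 + X 0 ^ 2 * X 1) + X 0 * (X 1 ^ 2 * X 2 ^ 3 + X 1 ^ 2 * X 3 ^ 3 + X 1 ^ 2) := by rw [hg]; ring
  rw [hdec]
  exact Ideal.add_mem _ (Ideal.mul_mem_right _ _ h4) (Ideal.mul_mem_right _ _ h0)

end Ring

/-! ## §2 The centre `(x̄, ȳ, z̄) ⊂ k[X]/(g₅)` is prime -/

section Centre

variable (k : Type) [Field k]

/-- The centre `(x̄, ȳ, z̄)` of `k[X]/(g₅)` is the image of `(x, y, z) ⊇ (g₅)`. [folklore] -/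
theorem span_centre_eq_map (g : MvPolynomial (Fin 5) k) :
    Ideal.span ((fun j : Fin 5 => Ideal.Quotient.mk (Ideal.span {g}) (X j)) '' (({0, 1, 4} : Finset (Fin 5)) : Set (Fin 5))) =
      (Ideal.span (X '' (({0, 1, 4} : Finset (Fin 5)) : Set (Fin 5)) : Set (MvPolynomial (Fin 5) k))).map (Ideal.Quotient.mk (Ideal.span {g})) := by
  rw [Ideal.map_span, Set.image_image]

/-- ★ `(x̄, ȳ, z̄) ⊂ k[X]/(g₅)` is PRIME (`k[X]/(g₅, x, y, z) = k[X]/(x, y, z) ≅ k[u, t]`). [folklore] -/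
theorem isPrime_centre (g : MvPolynomial (Fin 5) k) (hg : g = X 4 ^ 2 + X 0 ^ 2 * X 1 * X 4 + X 0 * X 1 ^ 2 * X 2 ^ 3 + X 0 * X 1 ^ 2 * X 3 ^ 3 + X 0 * X 1 ^ 2) :
    (Ideal.span ((fun j : Fin 5 => Ideal.Quotient.mk (Ideal.span {g}) (X j)) '' (({0, 1, 4} : Finset (Fin 5)) : Set (Fin 5)))).IsPrime := by
  rw [span_centre_eq_map]
  haveI := Literature.RingTheory.MvPolynomial.isPrime_span_X_image (R := k) ((({0, 1, 4} : Finset (Fin 5)) : Set (Fin 5)))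
  refine Ideal.map_isPrime_of_surjective Ideal.Quotient.mk_surjective ?_
  rw [Ideal.mk_ker, Ideal.span_le, Set.singleton_subset_iff]
  exact g5_mem_span_centre k g hg

end Centre

/-! ## §3 The chart open immersion `U₀ ⟶ Bl_{(x̄,ȳ,z̄)} U₀` -/

section Chart

variable (k : Type) [Field k]

/-- ★ **THE PERIOD-ONE CHART**: the `D(x̄ t)`-chart of `Bl_{(x̄,ȳ,z̄)} U₀` is `U₀` itself — an OPEN IMMERSION `U₀ ⟶ Bl_{(x̄,ȳ,z̄)} U₀` (the strict-transform presentation `k[X]/(g₅) ≅ (k[X]/(g₅))[I/x̄]`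
of `StrictTransformChartSub.strictTransformChartSub` with §1, composed with the chart `affineBlowup.chartι`). [folklore assembly; Stacks 0804] -/
theorem exists_chart_isOpenImmersion (g : MvPolynomial (Fin 5) k)
    (hg : g = X 4 ^ 2 + X 0 ^ 2 * X 1 * X 4 + X 0 * X 1 ^ 2 * X 2 ^ 3 + X 0 * X 1 ^ 2 * X 3 ^ 3 + X 0 * X 1 ^ 2) :
    ∃ j : Spec (.of (MvPolynomial (Fin 5) k ⧸ Ideal.span {g})) ⟶
        affineBlowup (Ideal.span ((fun j : Fin 5 => Ideal.Quotient.mk (Ideal.span {g}) (X j)) '' (({0, 1, 4} : Finset (Fin 5)) : Set (Fin 5)))),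
      IsOpenImmersion j := by
  have hi : (0 : Fin 5) ∈ ({0, 1, 4} : Finset (Fin 5)) := by simp
  obtain ⟨e, -⟩ := StrictTransformChartSub.strictTransformChartSub k 5 g g ({0, 1, 4} : Finset (Fin 5)) 0 hi 2 (isPrime_span_g5 k g hg)
    (X0_not_mem_span_g5 k g hg) (chart_identity_g5 k g hg) (fun j : Fin 5 => Ideal.Quotient.mk (Ideal.span {g}) (X j)) rfl
  exact ⟨Spec.map e.symm.toCommRingCatIso.hom ≫ affineBlowup.chartι
      (I := Ideal.span ((fun j : Fin 5 => Ideal.Quotient.mk (Ideal.span {g}) (X j)) '' (({0, 1, 4} : Finset (Fin 5)) : Set (Fin 5))))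
      (Ideal.Quotient.mk (Ideal.span {g}) (X 0)) (StrictTransformChartSub.mem_centre _ _ hi), inferInstance⟩

end Chart

/-! ## §4 Under the two-sided locus hypothesis: the centre identification and the receivers -/

section Receivers

variable (k : Type) [Field k] [CharP k 2]

omit [CharP k 2] in
/-- A non-FULL point of `U₀` (the generic point of `V(x̄,ȳ,z̄)`), from the locus hypothesis. [OURS] -/
theorem exists_not_fullCl (g : MvPolynomial (Fin 5) k)
    (hg : g = X 4 ^ 2 + X 0 ^ 2 * X 1 * X 4 + X 0 * X 1 ^ 2 * X 2 ^ 3 + X 0 * X 1 ^ 2 * X 3 ^ 3 + X 0 * X 1 ^ 2)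
    (hlocus : ∀ w : Spec (.of (MvPolynomial (Fin 5) k ⧸ Ideal.span {g})),
      ¬ FullCl 2 ((Spec (.of (MvPolynomial (Fin 5) k ⧸ Ideal.span {g}))).presheaf.stalk w) ↔
        Ideal.span ((fun j : Fin 5 => Ideal.Quotient.mk (Ideal.span {g}) (X j)) '' (({0, 1, 4} : Finset (Fin 5)) : Set (Fin 5))) ≤ w.asIdeal) :
    ∃ u : Spec (.of (MvPolynomial (Fin 5) k ⧸ Ideal.span {g})), ¬ FullCl 2 ((Spec (.of (MvPolynomial (Fin 5) k ⧸ Ideal.span {g}))).presheaf.stalk u) :=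
  haveI := isPrime_centre k g hg
  ⟨⟨Ideal.span ((fun j : Fin 5 => Ideal.Quotient.mk (Ideal.span {g}) (X j)) '' (({0, 1, 4} : Finset (Fin 5)) : Set (Fin 5))), inferInstance⟩,
    (hlocus _).mpr le_rfl⟩

omit [CharP k 2] in
/-- The non-FULL locus of `U₀` is the support of `(x̄,ȳ,z̄)~` (restatement of the hypothesis). [OURS] -/
theorem nonFullLocus_eq_support (g : MvPolynomial (Fin 5) k)
    (hlocus : ∀ w : Spec (.of (MvPolynomial (Fin 5) k ⧸ Ideal.span {g})),
      ¬ FullCl 2 ((Spec (.of (MvPolynomial (Fin 5) k ⧸ Ideal.span {g}))).presheaf.stalk w) ↔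
        Ideal.span ((fun j : Fin 5 => Ideal.Quotient.mk (Ideal.span {g}) (X j)) '' (({0, 1, 4} : Finset (Fin 5)) : Set (Fin 5))) ≤ w.asIdeal) :
    nonFullLocus 2 (Spec (.of (MvPolynomial (Fin 5) k ⧸ Ideal.span {g}))) =
      ((affineBlowup.idealSheaf (Ideal.span ((fun j : Fin 5 => Ideal.Quotient.mk (Ideal.span {g}) (X j)) '' (({0, 1, 4} : Finset (Fin 5)) : Set (Fin 5))))).support :
        Set (Spec (.of (MvPolynomial (Fin 5) k ⧸ Ideal.span {g})))) := by
  rw [affineBlowup.support_idealSheaf]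
  ext w
  exact hlocus w

/-- The non-FULL points of `U₀` are singular (regular ⇒ FULL, p640607), so the `∩ (Reg)ᶜ` of the recipe changes nothing. [OURS] -/
theorem nonFullLocus_inter_compl_regularLocus (g : MvPolynomial (Fin 5) k) :
    nonFullLocus 2 (Spec (.of (MvPolynomial (Fin 5) k ⧸ Ideal.span {g}))) ∩ (Scheme.regularLocus (Spec (.of (MvPolynomial (Fin 5) k ⧸ Ideal.span {g}))))ᶜ =
      nonFullLocus 2 (Spec (.of (MvPolynomial (Fin 5) k ⧸ Ideal.span {g}))) := by
  haveI : Fact (Nat.Prime 2) := ⟨Nat.prime_two⟩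
  refine Set.inter_eq_left.mpr fun w hw hreg => hw ?_
  exact RegTower.fullCl_stalk_of_mem_regularLocus 2 (Spec.map (CommRingCat.ofHom (algebraMap k (MvPolynomial (Fin 5) k ⧸ Ideal.span {g})))) w hreg

/-- ★ **`Recipes.nonFullCentre 2 U₀ = (x̄,ȳ,z̄)~`** under the locus hypothesis (closure of a closed set; the vanishing ideal sheaf of the support of a prime's ideal sheaf is itself).
[OURS · modulo `hlocus`] -/
theorem nonFullCentre_eq (g : MvPolynomial (Fin 5) k)
    (hg : g = X 4 ^ 2 + X 0 ^ 2 * X 1 * X 4 + X 0 * X 1 ^ 2 * X 2 ^ 3 + X 0 * X 1 ^ 2 * X 3 ^ 3 + X 0 * X 1 ^ 2)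
    (hlocus : ∀ w : Spec (.of (MvPolynomial (Fin 5) k ⧸ Ideal.span {g})),
      ¬ FullCl 2 ((Spec (.of (MvPolynomial (Fin 5) k ⧸ Ideal.span {g}))).presheaf.stalk w) ↔
        Ideal.span ((fun j : Fin 5 => Ideal.Quotient.mk (Ideal.span {g}) (X j)) '' (({0, 1, 4} : Finset (Fin 5)) : Set (Fin 5))) ≤ w.asIdeal) :
    nonFullCentre 2 (Spec (.of (MvPolynomial (Fin 5) k ⧸ Ideal.span {g}))) =
      affineBlowup.idealSheaf (Ideal.span ((fun j : Fin 5 => Ideal.Quotient.mk (Ideal.span {g}) (X j)) '' (({0, 1, 4} : Finset (Fin 5)) : Set (Fin 5)))) := by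
  haveI := isPrime_centre k g hg
  have hcl : (⟨closure (nonFullLocus 2 (Spec (.of (MvPolynomial (Fin 5) k ⧸ Ideal.span {g}))) ∩
      (Scheme.regularLocus (Spec (.of (MvPolynomial (Fin 5) k ⧸ Ideal.span {g}))))ᶜ), isClosed_closure⟩ : Closeds (Spec (.of (MvPolynomial (Fin 5) k ⧸ Ideal.span {g})))) =
      (affineBlowup.idealSheaf (Ideal.span ((fun j : Fin 5 => Ideal.Quotient.mk (Ideal.span {g}) (X j)) '' (({0, 1, 4} : Finset (Fin 5)) : Set (Fin 5))))).support := by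
    apply Closeds.ext
    change closure _ = _
    rw [nonFullLocus_inter_compl_regularLocus, nonFullLocus_eq_support k g hlocus]
    exact (Scheme.IdealSheafData.support _).isClosed.closure_eq
  change Scheme.IdealSheafData.vanishingIdeal _ = _
  rw [hcl, Scheme.IdealSheafData.vanishingIdeal_support, IntrinsicTower.InstanceTauFloorP2d4C.radical_idealSheaf_of_isPrime]

omit [CharP k 2] in
/-- The v1 intrinsic centre agrees: `IntrinsicTower.centre 2 U₀ = (x̄,ȳ,z̄)~` under the locus hypothesis. [OURS · modulo `hlocus`] -/
theorem centre_eq (g : MvPolynomial (Fin 5) k)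
    (hg : g = X 4 ^ 2 + X 0 ^ 2 * X 1 * X 4 + X 0 * X 1 ^ 2 * X 2 ^ 3 + X 0 * X 1 ^ 2 * X 3 ^ 3 + X 0 * X 1 ^ 2)
    (hlocus : ∀ w : Spec (.of (MvPolynomial (Fin 5) k ⧸ Ideal.span {g})),
      ¬ FullCl 2 ((Spec (.of (MvPolynomial (Fin 5) k ⧸ Ideal.span {g}))).presheaf.stalk w) ↔
        Ideal.span ((fun j : Fin 5 => Ideal.Quotient.mk (Ideal.span {g}) (X j)) '' (({0, 1, 4} : Finset (Fin 5)) : Set (Fin 5))) ≤ w.asIdeal) :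
    IntrinsicTower.centre 2 (Spec (.of (MvPolynomial (Fin 5) k ⧸ Ideal.span {g}))) =
      affineBlowup.idealSheaf (Ideal.span ((fun j : Fin 5 => Ideal.Quotient.mk (Ideal.span {g}) (X j)) '' (({0, 1, 4} : Finset (Fin 5)) : Set (Fin 5)))) := by
  haveI := isPrime_centre k g hg
  have hcl : (⟨closure (nonFullLocus 2 (Spec (.of (MvPolynomial (Fin 5) k ⧸ Ideal.span {g})))), isClosed_closure⟩ :
      Closeds (Spec (.of (MvPolynomial (Fin 5) k ⧸ Ideal.span {g})))) =
      (affineBlowup.idealSheaf (Ideal.span ((fun j : Fin 5 => Ideal.Quotient.mk (Ideal.span {g}) (X j)) '' (({0, 1, 4} : Finset (Fin 5)) : Set (Fin 5))))).support := by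
    apply Closeds.ext
    change closure _ = _
    rw [nonFullLocus_eq_support k g hlocus]
    exact (Scheme.IdealSheafData.support _).isClosed.closure_eq
  change Scheme.IdealSheafData.vanishingIdeal _ = _
  rw [hcl, Scheme.IdealSheafData.vanishingIdeal_support, IntrinsicTower.InstanceTauFloorP2d4C.radical_idealSheaf_of_isPrime]

/-- ★★ **THE N-RECIPE RECEIVER AT `U₀`**: NO scheme containing an open copy of `U₀` has an `N_red`-tower (`Recipes.nonFullCentre`) of any height ending FULL — the blow-up of `U₀` along its
N-centre `(x̄,ȳ,z̄)~` (§4) receives the open immersion `U₀ ⟶ Bl` (§3), and p635381's one-chart receiver closes. [OURS · modulo `hlocus`] -/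
theorem not_exists_nonFullTower_of_contains_U0 (g : MvPolynomial (Fin 5) k)
    (hg : g = X 4 ^ 2 + X 0 ^ 2 * X 1 * X 4 + X 0 * X 1 ^ 2 * X 2 ^ 3 + X 0 * X 1 ^ 2 * X 3 ^ 3 + X 0 * X 1 ^ 2)
    (hlocus : ∀ w : Spec (.of (MvPolynomial (Fin 5) k ⧸ Ideal.span {g})),
      ¬ FullCl 2 ((Spec (.of (MvPolynomial (Fin 5) k ⧸ Ideal.span {g}))).presheaf.stalk w) ↔
        Ideal.span ((fun j : Fin 5 => Ideal.Quotient.mk (Ideal.span {g}) (X j)) '' (({0, 1, 4} : Finset (Fin 5)) : Set (Fin 5))) ≤ w.asIdeal)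
    (S : Scheme.{0}) (hS : ∃ j : Spec (.of (MvPolynomial (Fin 5) k ⧸ Ideal.span {g})) ⟶ S, IsOpenImmersion j) :
    ¬ ∃ n : ℕ, RecipeTowerFull nonFullCentre 2 n S := by
  obtain ⟨j₀, hj₀⟩ := exists_chart_isOpenImmersion k g hg
  have hπ₀ : IsBlowup (affineBlowup.π (Ideal.span ((fun j : Fin 5 => Ideal.Quotient.mk (Ideal.span {g}) (X j)) '' (({0, 1, 4} : Finset (Fin 5)) : Set (Fin 5)))))
      (nonFullCentre 2 (Spec (.of (MvPolynomial (Fin 5) k ⧸ Ideal.span {g})))) := by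
    rw [nonFullCentre_eq k g hg hlocus]
    exact affineBlowup.isBlowup _
  exact not_exists_tower_of_recurrent_chart₁ (fun S s => FullCl 2 (S.presheaf.stalk s)) (fun π x _ h => fullCl_descends 2 π x h)
    (RecipeTowerFull nonFullCentre 2) (nonFullCentre 2) (fun _ h => h) (fun _ _ h => h) (fun j _ => nonFullCentreLiteral_local 2 j)
    _ (exists_not_fullCl k g hg hlocus) hπ₀ j₀ S hS

omit [CharP k 2] in
/-- The v1 twin: NO scheme containing an open copy of `U₀` has an intrinsic tower (`IntrinsicTower.TowerFull 2 n`) of any height. [OURS · modulo `hlocus`] -/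
theorem not_exists_towerFull_of_contains_U0 (g : MvPolynomial (Fin 5) k)
    (hg : g = X 4 ^ 2 + X 0 ^ 2 * X 1 * X 4 + X 0 * X 1 ^ 2 * X 2 ^ 3 + X 0 * X 1 ^ 2 * X 3 ^ 3 + X 0 * X 1 ^ 2)
    (hlocus : ∀ w : Spec (.of (MvPolynomial (Fin 5) k ⧸ Ideal.span {g})),
      ¬ FullCl 2 ((Spec (.of (MvPolynomial (Fin 5) k ⧸ Ideal.span {g}))).presheaf.stalk w) ↔
        Ideal.span ((fun j : Fin 5 => Ideal.Quotient.mk (Ideal.span {g}) (X j)) '' (({0, 1, 4} : Finset (Fin 5)) : Set (Fin 5))) ≤ w.asIdeal)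
    (S : Scheme.{0}) (hS : ∃ j : Spec (.of (MvPolynomial (Fin 5) k ⧸ Ideal.span {g})) ⟶ S, IsOpenImmersion j) :
    ¬ ∃ n : ℕ, IntrinsicTower.TowerFull 2 n S := by
  obtain ⟨j₀, hj₀⟩ := exists_chart_isOpenImmersion k g hg
  have hπ₀ : IsBlowup (affineBlowup.π (Ideal.span ((fun j : Fin 5 => Ideal.Quotient.mk (Ideal.span {g}) (X j)) '' (({0, 1, 4} : Finset (Fin 5)) : Set (Fin 5)))))
      (IntrinsicTower.centre 2 (Spec (.of (MvPolynomial (Fin 5) k ⧸ Ideal.span {g})))) := by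
    rw [centre_eq k g hg hlocus]
    exact affineBlowup.isBlowup _
  exact not_exists_towerFull_of_recurrent_chart₁ 2 _ (exists_not_fullCl k g hg hlocus) hπ₀ j₀ S hS

end Receivers

/-! ## §5 ★★ The refutations, modulo the floor package (NEG-0 + NEG-T) and the occurrence chain (NEG-1…5)

INTERFACE NOTE (res-L1-w45a-tri-2 «GAP (LOC)», bus 2026-08-28 l.81780). The floors `F i` below are the GLOBAL floors (`F 0 := Bl_𝔪 X` for the d4lx6c3 specimen
`X = {z² + x⁶z + y³ + u³ + t³}`, `F (i+1) = Bl_{N(F i)} F i`), and `hocc` is an open immersion of the global chart `U₀` into `F m`. The conjecture itself speaks about the LOCAL floor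
`S′ = F 0 ×_X Spec 𝒪_{X,v}`; `hfloor` is therefore delivered as the composite of the conjecture's instance at `S′` (NEG-0) with the LOCAL→GLOBAL TOWER TRANSFER at an isolated
singularity «NEG-T» (`(∃ n, RecipeTowerFull c 2 n S′) → ∃ n, RecipeTowerFull c 2 n (F 0)`, flat base change along `X.fromSpecStalk v`). With a LOCAL `F 0` the binder `hocc` would be
unsatisfiable (every morphism `U₀ → Spec 𝒪_{X,v}` is constant, `(k[X]/(g₅))ˣ = kˣ`), so the local reading is NOT the intended one. -/

section Occurrence

variable (k : Type) [Field k] [CharP k 2]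

/-- ★★ **`NonFullTowerConjecture` IS FALSE given the N-tower data of d4lx6c3**: a prefix `F 0 ← F 1 ← … ← F m` of blowing ups along the `N_red`-centres (`hg'`) with a non-FULL point on
every floor `F i`, `i < m` (`hbad`), the conjecture transported to the GLOBAL floor `F 0 = Bl_𝔪 X` (`hfloor` — NEG-0 + NEG-T, see the note above), and an open immersion `U₀ ⟶ F m` (`hocc`, NEG-1…5): then `F 0`
would carry a tower of some height (hfloor), pushed past the bad prefix to `F m` (p642899 `not_exists_tower_of_bad_prefix`), where §4 forbids it. [OURS · CONDITIONAL on the named data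
and `hlocus`; nothing of the crux proved] -/
theorem not_nonFullTowerConjecture_of_occurrence (g : MvPolynomial (Fin 5) k)
    (hg : g = X 4 ^ 2 + X 0 ^ 2 * X 1 * X 4 + X 0 * X 1 ^ 2 * X 2 ^ 3 + X 0 * X 1 ^ 2 * X 3 ^ 3 + X 0 * X 1 ^ 2)
    (hlocus : ∀ w : Spec (.of (MvPolynomial (Fin 5) k ⧸ Ideal.span {g})),
      ¬ FullCl 2 ((Spec (.of (MvPolynomial (Fin 5) k ⧸ Ideal.span {g}))).presheaf.stalk w) ↔
        Ideal.span ((fun j : Fin 5 => Ideal.Quotient.mk (Ideal.span {g}) (X j)) '' (({0, 1, 4} : Finset (Fin 5)) : Set (Fin 5))) ≤ w.asIdeal)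
    (m : ℕ) (F : ℕ → Scheme.{0}) (g' : ∀ i : ℕ, F (i + 1) ⟶ F i)
    (hfloor : NonFullTowerConjecture → ∃ n : ℕ, RecipeTowerFull nonFullCentre 2 n (F 0))
    (hg' : ∀ i, i < m → IsBlowup (g' i) (nonFullCentre 2 (F i)))
    (hbad : ∀ i, i < m → ∃ s : F i, ¬ FullCl 2 ((F i).presheaf.stalk s))
    (hocc : ∃ j : Spec (.of (MvPolynomial (Fin 5) k ⧸ Ideal.span {g})) ⟶ F m, IsOpenImmersion j) :
    ¬ NonFullTowerConjecture := by
  intro hNN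
  have hend : ¬ ∃ n : ℕ, RecipeTowerFull nonFullCentre 2 n (F m) := not_exists_nonFullTower_of_contains_U0 k g hg hlocus (F m) hocc
  exact not_exists_tower_of_bad_prefix (fun S s => FullCl 2 (S.presheaf.stalk s)) (RecipeTowerFull nonFullCentre 2) (nonFullCentre 2)
    (fun _ h => h) (fun _ _ h => h) m F g' hg' hbad hend (hfloor hNN)

omit [CharP k 2] in
/-- The v1 twin: **`IntrinsicTowerConjecture` IS FALSE given the same data for the intrinsic centre.** [OURS · CONDITIONAL on the named data and `hlocus`] -/
theorem not_intrinsicTowerConjecture_of_occurrence (g : MvPolynomial (Fin 5) k)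
    (hg : g = X 4 ^ 2 + X 0 ^ 2 * X 1 * X 4 + X 0 * X 1 ^ 2 * X 2 ^ 3 + X 0 * X 1 ^ 2 * X 3 ^ 3 + X 0 * X 1 ^ 2)
    (hlocus : ∀ w : Spec (.of (MvPolynomial (Fin 5) k ⧸ Ideal.span {g})),
      ¬ FullCl 2 ((Spec (.of (MvPolynomial (Fin 5) k ⧸ Ideal.span {g}))).presheaf.stalk w) ↔
        Ideal.span ((fun j : Fin 5 => Ideal.Quotient.mk (Ideal.span {g}) (X j)) '' (({0, 1, 4} : Finset (Fin 5)) : Set (Fin 5))) ≤ w.asIdeal)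
    (m : ℕ) (F : ℕ → Scheme.{0}) (g' : ∀ i : ℕ, F (i + 1) ⟶ F i)
    (hfloor : IntrinsicTowerConjecture → ∃ n : ℕ, IntrinsicTower.TowerFull 2 n (F 0))
    (hg' : ∀ i, i < m → IsBlowup (g' i) (IntrinsicTower.centre 2 (F i)))
    (hbad : ∀ i, i < m → ∃ s : F i, ¬ FullCl 2 ((F i).presheaf.stalk s))
    (hocc : ∃ j : Spec (.of (MvPolynomial (Fin 5) k ⧸ Ideal.span {g})) ⟶ F m, IsOpenImmersion j) :
    ¬ IntrinsicTowerConjecture := by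
  intro hTT
  have hend : ¬ ∃ n : ℕ, IntrinsicTower.TowerFull 2 n (F m) := not_exists_towerFull_of_contains_U0 k g hg hlocus (F m) hocc
  exact not_exists_tower_of_bad_prefix (fun S s => FullCl 2 (S.presheaf.stalk s)) (IntrinsicTower.TowerFull 2) (IntrinsicTower.centre 2)
    (fun _ h => h) (fun _ _ h => h) m F g' hg' hbad hend (hfloor hTT)

end Occurrence

end Summit.ResolutionOfSingularities.ResolutionOfSingularities.Theorems.FInjectiveMacaulayfication.NonFullLoopFrame

end
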